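import Summits.BirchSwinnertonDyer.BirchSwinnertonDyer.Theorems.PrintX11aUpperNonSurjFiveCartanDescentLocal
import Summits.BirchSwinnertonDyer.BirchSwinnertonDyer.Theorems.PrintX11aUpperNonSurjFiveCartanGlobal
import Summits.BirchSwinnertonDyer.BirchSwinnertonDyer.Theorems.PrintX11aUpperNonSurjFiveShaAnIntegralOfPrint

/-!
# Line «gl1cartan5» of crux U5 `Theses.PrintX11a.UpperNonSurjFive` — stub D (Cartan descent), part 3/3: dispatch at `w ∤ p`, the
# assembly `stub_cartanDescent`, and the SECTOR of U5 the line proves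

(§6) At a place `w ∤ p` of `K` above the rational prime `ℓ`, `loc_w(π_*(res_K x))` is unramified for `x ∈ Sel_p(E/ℚ)`: additive
reduction at `ℓ` over `ℚ` with `p ≥ 5` gives `E(ℚ_ℓ)[p] = 0`, so the class dies already at `ℓ`; good reduction at `w` makes the Kummer
condition `H¹_ur` (X11b); multiplicative reduction is NONSPLIT at `w` by the datum, again `H¹_ur`.  (§7) The assembly: with `L'` from
D-G (`stub_cartanGlobal`, p652784) the map `x ↦ π_*(res_K x)` sends `Sel_p(E/ℚ)` injectively into the GL₁ Selmer group `S(𝒟)`, so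
`S(𝒟) = 0 ⇒ #Sel_p(E/ℚ) ≤ 1` — the registered stub D `stub_cartanDescent`.  (§8) The SECTOR theorem
`upperNonSurjFive_on_selmerTrivialMainLocus`: on the main locus with some datum of trivial GL₁ Selmer group, U5's conclusion
`MissingUpperBoundAt W p` holds CONDITIONALLY on three named print facts taken as hypotheses (Gross–Zagier–Kolyvagin
`rank_eq_analyticRank_of_analyticRank_le_one`, modularity `exists_isNewformOf`, Mazur's Manin-constant theorem
`mazur_not_dvd_maninConstant_of_odd`) through the landed bridge `shaAnIntegral_of_mazur` (p654623).  What U5 still lacks after this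
file is exactly its complement sector (off the main locus, or no datum with `S(𝒟) = 0`) — recorded as sorried stubs R₁/R₂ in the crux
workfile, not here.  Lead `cruxlead-stmt-BirchSwinnertonDyer-20614` g0, cell `bsd-print-x11a`.

BSD is not proved by any of this; nothing is asserted about any particular curve; no statement of the summit is proved here.

References: [MazurRubin2004] Def. 2.1.1; [Serre1972] §1.12, §2.8; [SerreGaloisCohomology1997] I.§2, I.§5; [SilvermanAEC2009] X.4.2,
Cor. X.4.4, VII.6; [SilvermanATAEC1994] V.3.1, V.5.2–5.4; [GrossLMS1991] §5 (5.1); [MilneADT2006] I.3.8; [Wuthrich2014] Thm. 1, Cor. 7; [Mazur1978] Cor. 4.1.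
-/


-- justified: the file namespace `Summit.BirchSwinnertonDyer.BirchSwinnertonDyer.Theorems.GL1Cartan` repeats the sub-problem segment by the D-0017 layout
set_option linter.dupNamespace false
set_option autoImplicit false

noncomputable section

open scoped Classical NumberField ContRepresentation

open WeierstrassCurve Field IsDedekindDomain NumberField
  Literature.NumberTheory.EllipticCurves
  Literature.NumberTheory.EllipticCurves.Rank1Residual
  Literature.NumberTheory.EllipticCurves.Rank1Residual.Typed
  Literature.NumberTheory.GaloisRepresentations
  Literature.NumberTheory.GaloisRepresentations.DiscreteGaloisModule
  Literature.NumberTheory.SerreUniformity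
  Summit.BirchSwinnertonDyer.Rank1Residual

namespace Summit.BirchSwinnertonDyer.BirchSwinnertonDyer.Theorems.GL1Cartan


/-! ## §6 The three reduction types of `E` at the prime `ℓ` below `w ∤ p` -/

section Dispatch

variable {W : WeierstrassCurve ℚ} [W.IsElliptic] [W.IsGloballyMinimal] {p : ℕ} [Fact p.Prime]
  (𝒟 : CartanDatum W p)
  (L' : AddSubgroup ((W.baseChange 𝒟.K).geomTorsion (p : ℤ)))
  (hL'card : Nat.card L' = p) (hLL' : 𝒟.line ⊓ L' = ⊥)
  (hL'stab : ∀ (σ : absoluteGaloisGroup 𝒟.K) (P : (W.baseChange 𝒟.K).geomTorsion (p : ℤ)),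
    P ∈ L' → σ • P ∈ L')

namespace CartanDatum

omit [W.IsGloballyMinimal] in
/-- **(A) `E` additive at `ℓ`** (`ℓ ≠ p`, `p ≥ 5`): `E(ℚ_ℓ)[p] = 0` (Kodaira–Néron, `c_ℓ ≤ 4 < p`, `#Ẽ_ns(𝔽_ℓ) = ℓ`;
`natCard_primePowTorsion_eq_one_of_hasAdditiveReductionAt`), so `H¹(ℚ_ℓ, E[p]) = 0` and `loc_ℓ x = 0`; the strict
local vanishing passes to `w ∣ ℓ` under restriction (`resTorsion_mem_torsionLocalKer_of_under`), hence
`loc_w(π_* res x) = 0`. [cite: SilvermanAEC2009, Thm. VII.6.1] [cite: MilneADT2006, Ch. I Cor. 2.3] -/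
theorem localization_projH1_resTorsion_eq_zero_of_additive (hp5 : 5 ≤ p) {w : HeightOneSpectrum (𝓞 𝒟.K)}
    {ℓ : ℕ} [Fact ℓ.Prime] (hℓp : ℓ ≠ p) (hℓw : ((ℓ : ℕ) : 𝓞 𝒟.K) ∈ w.asIdeal)
    (hgood : ¬ W.HasGoodReductionAtPrime ℓ) (hmult : ¬ W.HasMultiplicativeReductionAtPrime ℓ)
    (x : galH1Torsion W (p : ℤ)) :
    galoisCohomology.localization 𝒟.ρ (Sum.inr w) 1
      (𝒟.projH1 L' hL'card hLL' hL'stab (resTorsion W 𝒟.K (p : ℤ) x)) = 0 := by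
  have hp : p.Prime := Fact.out
  have hℓ : ℓ.Prime := Fact.out
  haveI : (W.baseChange 𝒟.K).IsElliptic := by rw [baseChange]; infer_instance
  -- the place `u` of `ℚ` below `w` is `(ℓ)`
  set u : HeightOneSpectrum (𝓞 ℚ) := w.under (𝓞 ℚ) with hu
  have hℓu : (ℓ : 𝓞 ℚ) ∈ u.asIdeal := by
    rw [hu, HeightOneSpectrum.under_asIdeal, Ideal.under_def, Ideal.mem_comap, map_natCast]
    exact hℓw
  -- `primesEquiv u = q` for every rational prime `q ∈ u`
  have hgen : ∀ {q : ℕ}, q.Prime → (q : 𝓞 ℚ) ∈ u.asIdeal → (Rat.HeightOneSpectrum.primesEquiv u : ℕ) = q := by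
    intro q hq hqu
    have h1 : Rat.HeightOneSpectrum.natGenerator u ∣ q := by
      rw [Rat.HeightOneSpectrum.natGenerator_dvd_iff]
      have h2 := Ideal.mem_map_of_mem (Rat.IsIntegralClosure.intEquiv (𝓞 ℚ)) hqu
      rwa [map_natCast] at h2
    exact (Nat.prime_dvd_prime_iff_eq (Rat.HeightOneSpectrum.prime_natGenerator u) hq).mp h1
  have hequ : (Rat.HeightOneSpectrum.primesEquiv u : ℕ) = ℓ := hgen hℓ hℓu
  -- `E` is additive at `u`
  have hadd : W.HasAdditiveReductionAt u := by
    rcases W.hasGoodReductionAt_or_hasMultiplicativeReductionAt_or_hasAdditiveReductionAt u with h | h | h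
    · exact absurd ((hasGoodReductionAtPrime_primesEquiv_iff_holds W u ℓ hequ).mpr h) hgood
    · exact absurd ((hasMultiplicativeReductionAtPrime_primesEquiv_iff_holds W u ℓ hequ).mpr h) hmult
    · exact h
  -- `p ∉ u`
  have hpu : (p : 𝓞 ℚ) ∉ u.asIdeal := fun h => by
    have := hgen hp h
    rw [hequ] at this
    exact hℓp this
  -- `E(ℚ_u)[p] = 0`
  have htors : ∀ P : (W.baseChange (u.adicCompletion ℚ)).toAffine.Point, p • P = 0 → P = 0 := by
    intro P hP
    have hcard := W.natCard_primePowTorsion_eq_one_of_hasAdditiveReductionAt u hadd hp hp5 hpu 1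
    rw [pow_one] at hcard
    haveI : Subsingleton ((nsmulAddMonoidHom p :
        (W.baseChange (u.adicCompletion ℚ)).toAffine.Point →+ _).ker) :=
      (Nat.card_eq_one_iff_unique.mp hcard).1
    have hmem : P ∈ (nsmulAddMonoidHom p : (W.baseChange (u.adicCompletion ℚ)).toAffine.Point →+ _).ker := hP
    have h0 : (⟨P, hmem⟩ : (nsmulAddMonoidHom p :
        (W.baseChange (u.adicCompletion ℚ)).toAffine.Point →+ _).ker) = ⟨0, AddSubgroup.zero_mem _⟩ :=
      Subsingleton.elim _ _
    exact congrArg Subtype.val h0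
  haveI : NeZero p := ⟨hp.ne_zero⟩
  have hsub := subsingleton_galoisCohomology_one_torsion_adicCompletion_of_forall_nsmul_eq_zero W u p hpu htors
  have hx0 : galoisCohomology.res (W.torsionGaloisModule (p : ℤ)) (u.adicCompletion ℚ) 1 x = 0 :=
    @Subsingleton.elim _ hsub _ _
  have hxker : x ∈ W.torsionLocalKer (u.adicCompletion ℚ) (p : ℤ) :=
    mem_torsionLocalKer_of_res_torsionGaloisModule_eq_zero W _ x hx0
  have hres : resTorsion W 𝒟.K (p : ℤ) x ∈ (W.baseChange 𝒟.K).torsionLocalKer (w.adicCompletion 𝒟.K) (p : ℤ) :=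
    resTorsion_mem_torsionLocalKer_of_under W 𝒟.K (p : ℤ) w hxker
  haveI : CharZero (w.adicCompletion 𝒟.K) :=
    charZero_of_injective_algebraMap (algebraMap 𝒟.K (w.adicCompletion 𝒟.K)).injective
  have hres0 : galoisCohomology.res ((W.baseChange 𝒟.K).torsionGaloisModule (p : ℤ)) (w.adicCompletion 𝒟.K) 1
      (resTorsion W 𝒟.K (p : ℤ) x) = 0 :=
    (mem_torsionLocalKer_iff_res_eq_zero (W := W.baseChange 𝒟.K) (E := w.adicCompletion 𝒟.K) hp.ne_zero _).mp hres
  change galoisCohomology.res 𝒟.ρ (Place.Completion (Sum.inr w : Place 𝒟.K)) 1 _ = 0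
  rw [res_projH1]
  change galoisCohomology.map _ 1 (galoisCohomology.res ((W.baseChange 𝒟.K).torsionGaloisModule (p : ℤ))
      (w.adicCompletion 𝒟.K) 1 (resTorsion W 𝒟.K (p : ℤ) x)) = 0
  rw [hres0, map_zero]

/-- **(B) `E` good at `ℓ`** (`ℓ ≠ p`): `E_K` is good at `w ∣ ℓ` (`ℓ ∤ Δ_min`, integral model), so the Kummer condition
at `w` is `H¹_ur` (`X11b.KummerPT.kummerSelmerStructure_inr_eq_unramifiedSubgroup`, Cor. X.4.4 / Milne I.3.8) and
`loc_w(π_* s)` is unramified. [cite: SilvermanAEC2009, Cor. X.4.4] [cite: MilneADT2006, Ch. I Prop. 3.8] -/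
theorem localization_projH1_mem_unramifiedSubgroup_of_good {w : HeightOneSpectrum (𝓞 𝒟.K)}
    (hpw : ((p : ℕ) : 𝓞 𝒟.K) ∉ w.asIdeal) {ℓ : ℕ} [Fact ℓ.Prime] (hℓw : ((ℓ : ℕ) : 𝓞 𝒟.K) ∈ w.asIdeal)
    (hgood : W.HasGoodReductionAtPrime ℓ)
    (s : galH1Torsion (W.baseChange 𝒟.K) (p : ℤ)) (hs : s ∈ selmerGroup (W.baseChange 𝒟.K) (p : ℤ)) :
    galoisCohomology.localization 𝒟.ρ (Sum.inr w) 1 (𝒟.projH1 L' hL'card hLL' hL'stab s) ∈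
      unramifiedSubgroup (GaloisRep.toLocal w 𝒟.ρ) 1 := by
  have hℓ : ℓ.Prime := Fact.out
  haveI : (W.baseChange 𝒟.K).IsElliptic := by rw [baseChange]; infer_instance
  -- `E_K` has good reduction at `w`
  have hΔ : ¬ (ℓ : ℤ) ∣ minimalDiscriminantInt W := not_dvd_minimalDiscriminantInt_of_hasGoodReductionAtPrime' W ℓ hgood
  have hΔw : ((integralModelInt W).Δ : 𝓞 𝒟.K) ∉ w.asIdeal := by
    intro hmem
    have hcop : IsCoprime (ℓ : ℤ) (integralModelInt W).Δ :=
      (Nat.prime_iff_prime_int.mp hℓ).coprime_iff_not_dvd.mpr hΔ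
    obtain ⟨a, b, hab⟩ := hcop
    have h1 : (1 : 𝓞 𝒟.K) ∈ w.asIdeal := by
      have := congrArg (fun z : ℤ => (z : 𝓞 𝒟.K)) hab
      simp only [Int.cast_add, Int.cast_mul, Int.cast_one, Int.cast_natCast] at this
      rw [← this]
      exact w.asIdeal.add_mem (w.asIdeal.mul_mem_left _ hℓw) (w.asIdeal.mul_mem_left _ hmem)
    exact w.isPrime.ne_top ((Ideal.eq_top_iff_one _).mpr h1)
  have hgoodK : (W.baseChange 𝒟.K).HasGoodReductionAt w := by
    have h := hasGoodReductionAt_baseChange_map_int_of_notMem (integralModelInt W) 𝒟.K w hΔw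
    rwa [map_integralModelInt] at h
  -- Kummer = unramified at `w`
  have heq : (W.baseChange 𝒟.K).kummerSelmerStructure (p : ℤ) (Sum.inr w) =
      unramifiedSubgroup (GaloisRep.toLocal w ((W.baseChange 𝒟.K).torsionGaloisModule (p : ℤ))) 1 := by
    have key : ∀ n : ℤ, n = ((p ^ 1 : ℕ) : ℤ) → (W.baseChange 𝒟.K).kummerSelmerStructure n (Sum.inr w) =
        unramifiedSubgroup (GaloisRep.toLocal w ((W.baseChange 𝒟.K).torsionGaloisModule n)) 1 := by
      rintro n rfl
      exact X11b.KummerPT.kummerSelmerStructure_inr_eq_unramifiedSubgroup (W.baseChange 𝒟.K) p 1 hpw hgoodK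
    exact key (p : ℤ) (by rw [pow_one])
  exact 𝒟.localization_projH1_mem_unramifiedSubgroup_of_eq L' hL'card hLL' hL'stab w heq s hs

/-- **(C) `E` multiplicative at `ℓ ≠ p`**: `E_K` is multiplicative at `w ∣ ℓ` (base change of the global minimal
model) and NON-SPLIT there (the datum's `nonsplitAway`), so the Kummer condition at `w` is `H¹_ur`
(`kummerSelmerStructure_inr_eq_unramifiedSubgroup_of_nonsplit_prime`) and `loc_w(π_* s)` is unramified.
[cite: MilneADT2006, Ch. I Prop. 3.8] [cite: SilvermanAEC2009, Thm. VII.6.1] -/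
theorem localization_projH1_mem_unramifiedSubgroup_of_mult (hp2 : p ≠ 2) {w : HeightOneSpectrum (𝓞 𝒟.K)}
    (hpw : ((p : ℕ) : 𝓞 𝒟.K) ∉ w.asIdeal) {ℓ : ℕ} [Fact ℓ.Prime] (hℓw : ((ℓ : ℕ) : 𝓞 𝒟.K) ∈ w.asIdeal)
    (hmult : W.HasMultiplicativeReductionAtPrime ℓ)
    (s : galH1Torsion (W.baseChange 𝒟.K) (p : ℤ)) (hs : s ∈ selmerGroup (W.baseChange 𝒟.K) (p : ℤ)) :
    galoisCohomology.localization 𝒟.ρ (Sum.inr w) 1 (𝒟.projH1 L' hL'card hLL' hL'stab s) ∈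
      unramifiedSubgroup (GaloisRep.toLocal w 𝒟.ρ) 1 := by
  haveI : (W.baseChange 𝒟.K).IsElliptic := by rw [baseChange]; infer_instance
  have hmultK : (W.baseChange 𝒟.K).HasMultiplicativeReductionAt w :=
    (Additive.isMinimalAt_and_hasMultiplicativeReductionAt_baseChange_of_mult W hmult w hℓw).2
  have hns : ¬ (W.baseChange 𝒟.K).HasSplitMultiplicativeReductionAt w := 𝒟.nonsplitAway w ℓ hpw hℓw hmult
  have heq := GaloisImage.InertiaDivisible.kummerSelmerStructure_inr_eq_unramifiedSubgroup_of_nonsplit_prime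
    (W.baseChange 𝒟.K) p hpw hp2 hmultK hns
  exact 𝒟.localization_projH1_mem_unramifiedSubgroup_of_eq L' hL'card hLL' hL'stab w heq s hs

/-- **(D) Dispatcher at `w ∤ p`**: for `x ∈ Sel_p(E/ℚ)`, `loc_w(π_* res x)` is unramified, by (A)/(B)/(C) according
to the reduction of `E` at the prime `ℓ` below `w`. [cite: MazurRubin2004, Def. 2.1.1] -/
theorem localization_projH1_resTorsion_mem_unramifiedSubgroup (hp5 : 5 ≤ p) {w : HeightOneSpectrum (𝓞 𝒟.K)}
    (hpw : ((p : ℕ) : 𝓞 𝒟.K) ∉ w.asIdeal)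
    (x : galH1Torsion W (p : ℤ)) (hx : x ∈ W.selmerGroup (p : ℤ)) :
    galoisCohomology.localization 𝒟.ρ (Sum.inr w) 1
      (𝒟.projH1 L' hL'card hLL' hL'stab (resTorsion W 𝒟.K (p : ℤ) x)) ∈
      unramifiedSubgroup (GaloisRep.toLocal w 𝒟.ρ) 1 := by
  have hp : p.Prime := Fact.out
  have hp2 : p ≠ 2 := by omega
  -- the rational prime below `w`
  haveI : w.asIdeal.IsPrime := w.isPrime
  haveI : NeZero w.asIdeal := ⟨by rw [Ideal.zero_eq_bot]; exact w.ne_bot⟩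
  obtain ⟨ℓ, hℓ, hℓw⟩ : ∃ ℓ : ℕ, ℓ.Prime ∧ ((ℓ : ℕ) : 𝓞 𝒟.K) ∈ w.asIdeal :=
    ⟨_, Nat.absNorm_under_prime w.asIdeal, Int.absNorm_under_mem w.asIdeal⟩
  haveI : Fact ℓ.Prime := ⟨hℓ⟩
  have hℓp : ℓ ≠ p := by rintro rfl; exact hpw hℓw
  have hs : resTorsion W 𝒟.K (p : ℤ) x ∈ selmerGroup (W.baseChange 𝒟.K) (p : ℤ) :=
    resTorsion_mem_selmerGroup W 𝒟.K (p : ℤ) hx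
  by_cases hgood : W.HasGoodReductionAtPrime ℓ
  · exact 𝒟.localization_projH1_mem_unramifiedSubgroup_of_good L' hL'card hLL' hL'stab hpw hℓw hgood _ hs
  by_cases hmult : W.HasMultiplicativeReductionAtPrime ℓ
  · exact 𝒟.localization_projH1_mem_unramifiedSubgroup_of_mult L' hL'card hLL' hL'stab hp2 hpw hℓw hmult _ hs
  · rw [𝒟.localization_projH1_resTorsion_eq_zero_of_additive L' hL'card hLL' hL'stab hp5 hℓp hℓw hgood hmult x]
    exact AddSubgroup.zero_mem _

end CartanDatum

end Dispatch

/-! ## §7 The assembly: stub D -/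

/-- **Stub D of line gl1cartan5 — the Cartan descent bound.** For minimal `E/ℚ` in class X11a at `p ≥ 5` with split-Cartan-
normaliser image and NONSPLIT multiplicative reduction at `p`: if a Cartan descent datum `𝒟` has trivial GL₁ Selmer group
`S(𝒟) = H¹_𝓛(K, M) = 0`, then `#Sel_p(E/ℚ) ≤ 1`.  Proof: with `L'` from D-G (`stub_cartanGlobal`) the map `x ↦ π_*(res_K x)` sends
`Sel_p(E/ℚ)` into `S(𝒟)` (nothing at `𝔭`; STRICT at `𝔭'` by D-L (`stub_cartanLocalMult`) and `le_of_tateLine`; UNRAMIFIED at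
`w ∤ p` by the dispatcher `localization_projH1_resTorsion_mem_unramifiedSubgroup`) and is injective (kernel criterion
`exists_valued_of_projH1_eq_zero` + the last clause of D-G), so `#Sel_p(E/ℚ) ≤ #S(𝒟) ≤ 1`.  (The hypotheses «split-Cartan-
normaliser image» and «not split multiplicative at `p`» are part of the registered statement and are not used by the argument.)
[cite: MazurRubin2004, Def. 2.1.1] [cite: SilvermanAEC2009, Thm. X.4.2] -/
theorem stub_cartanDescent :
    ∀ (W : WeierstrassCurve ℚ) [W.IsElliptic] [W.IsGloballyMinimal] (p : ℕ) [Fact p.Prime],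
      ClassX11a W p → 5 ≤ p → HasSplitCartanNormalizerModPImage W p →
      W.HasMultiplicativeReductionAtPrime p → ¬ W.HasSplitMultiplicativeReductionAtPrime p →
      ∀ 𝒟 : CartanDatum W p, 𝒟.SelmerTrivial → Nat.card (W.selmerGroup (p : ℤ)) ≤ 1 := by
  intro W _ _ p _ hX hp5 _hCartan hmult _hns 𝒟 h𝒟
  have hp : p.Prime := Fact.out
  have hp2 : p ≠ 2 := by omega
  haveI : (W.baseChange 𝒟.K).IsElliptic := by rw [baseChange]; infer_instance
  have hirr : W.HasIrreducibleModPGaloisRep p := hX.2.2.2.1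
  -- the complement line from D-G
  obtain ⟨L', hL'card, hL'stab, hLL', hinj⟩ :=
    stub_cartanGlobal 𝒟.K 𝒟.finrank_eq_two W p hp2 hirr 𝒟.line 𝒟.natCard_line 𝒟.smul_mem_line
  -- membership in `S(𝒟)`
  have hmem : ∀ x ∈ W.selmerGroup (p : ℤ),
      𝒟.projH1 L' hL'card hLL' hL'stab (resTorsion W 𝒟.K (p : ℤ) x) ∈ 𝒟.selmerStructure.selmerGroup := by
    intro x hx
    have hs : resTorsion W 𝒟.K (p : ℤ) x ∈ selmerGroup (W.baseChange 𝒟.K) (p : ℤ) :=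
      resTorsion_mem_selmerGroup W 𝒟.K (p : ℤ) hx
    rw [CartanDatum.selmerStructure, SelmerStructure.mem_selmerGroup_ofFinite_iff]
    intro w
    by_cases h1 : w = 𝒟.𝔭
    · rw [if_pos h1]; exact AddSubgroup.mem_top _
    rw [if_neg h1]
    by_cases h2 : w = 𝒟.𝔭'
    · rw [if_pos h2]
      subst h2
      exact AddSubgroup.mem_bot.mpr (𝒟.localization_𝔭'_projH1_eq_zero L' hL'card hLL' hL'stab hp2 hmult _ hs)
    · rw [if_neg h2]
      exact 𝒟.localization_projH1_resTorsion_mem_unramifiedSubgroup L' hL'card hLL' hL'stab hp5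
        (𝒟.not_mem_of_ne h1 h2) x hx
  -- the map and its injectivity
  let f : W.selmerGroup (p : ℤ) → 𝒟.selmerStructure.selmerGroup := fun x =>
    ⟨𝒟.projH1 L' hL'card hLL' hL'stab (resTorsion W 𝒟.K (p : ℤ) x), hmem x x.2⟩
  have hf : Function.Injective f := by
    intro x y hxy
    apply Subtype.ext
    have h0 : 𝒟.projH1 L' hL'card hLL' hL'stab (resTorsion W 𝒟.K (p : ℤ) (x - y : galH1Torsion W (p : ℤ))) = 0 := by
      rw [map_sub, map_sub, sub_eq_zero]
      exact congrArg Subtype.val hxy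
    have hxy0 : (x : galH1Torsion W (p : ℤ)) - y = 0 :=
      hinj _ (𝒟.exists_valued_of_projH1_eq_zero L' hL'card hLL' hL'stab _ h0)
    exact sub_eq_zero.mp hxy0
  -- count
  haveI : Finite 𝒟.selmerStructure.selmerGroup := h𝒟.1
  exact (Nat.card_le_card_of_injective f hf).trans h𝒟.2


/-! ## §8 The sector of U5 proved by the line (conditional on three named print facts) -/

/-- On the main locus no prime at all is split multiplicative (at `p` by hypothesis, at `ℓ ≠ p` by the datum). [folklore] -/
theorem not_hasSplitMultiplicativeReductionAtPrime_of_mainLocus {W : WeierstrassCurve ℚ} [W.IsElliptic] {p : ℕ}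
    [Fact p.Prime] (hL : MainLocus W p) (ℓ : ℕ) [Fact ℓ.Prime] : ¬ W.HasSplitMultiplicativeReductionAtPrime ℓ := by
  obtain ⟨-, -, hns, ⟨𝒟⟩⟩ := hL
  by_cases hℓ : ℓ = p
  · subst hℓ; exact hns
  · intro hsplit
    exact (𝒟.splitAway ℓ hℓ hsplit.hasMultiplicativeReductionAtPrime).1 hsplit

/-- **The sector of U5 = `Theses.PrintX11a.UpperNonSurjFive` settled by line gl1cartan5 (CONDITIONAL on three named print facts).**
For minimal `E/ℚ` in class X11a at a non-surjective `p ≥ 5` ON THE MAIN LOCUS (split-Cartan-normaliser image, `p` nonsplit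
multiplicative, a Cartan descent datum exists) and admitting a datum `𝒟` with trivial GL₁ Selmer group `S(𝒟) = 0`, the `p`-part of
the upper bound holds: `MissingUpperBoundAt W p`.  Proof: `#Sel_p(E/ℚ) ≤ 1` by `stub_cartanDescent`; `#Ш_an(E) ∈ ℤ_(p)` by the bridge
`shaAnIntegral_of_mazur` (no split multiplicative prime on the main locus); conclude by
`ClassX11a.missingUpperBoundAt_of_card_selmerGroup_le_one`.  The hypotheses `hGZK` (Gross–Zagier–Kolyvagin), `hnf` (modularity)
and `hMz` (Mazur, Manin constant at odd `p`) are the tree's named print facts, undischarged here (conditional result); the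
hypothesis `¬ Surj W p` is carried for the shape of U5 and not used.  [cite: Wuthrich2014, Thm. 1 and Cor. 7] [cite: Mazur1978, Cor. 4.1]
[cite: MazurRubin2004, Def. 2.1.1] -/
theorem upperNonSurjFive_on_selmerTrivialMainLocus
    (hGZK : rank_eq_analyticRank_of_analyticRank_le_one)
    (hnf : Literature.NumberTheory.EllipticCurves.ModularForms.exists_isNewformOf)
    (hMz : Literature.NumberTheory.EllipticCurves.ModularForms.mazur_not_dvd_maninConstant_of_odd) :
    ∀ (W : WeierstrassCurve ℚ) [W.IsElliptic] [W.IsGloballyMinimal] (p : ℕ) [Fact p.Prime],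
      ClassX11a W p → ¬ Surj W p → 5 ≤ p → MainLocus W p → (∃ 𝒟 : CartanDatum W p, 𝒟.SelmerTrivial) →
      MissingUpperBoundAt W p := by
  intro W _ _ p _ hX _ hp5 hL h𝒟
  obtain ⟨𝒟, h𝒟⟩ := h𝒟
  obtain ⟨q, hq, hv⟩ := shaAnIntegral_of_mazur hnf hMz hGZK W p hX hp5
    (fun ℓ _ => not_hasSplitMultiplicativeReductionAtPrime_of_mainLocus hL ℓ)
  exact hX.missingUpperBoundAt_of_card_selmerGroup_le_one hGZK hq hv
    (stub_cartanDescent W p hX hp5 hL.1 hL.2.1 hL.2.2.1 𝒟 h𝒟)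

end Summit.BirchSwinnertonDyer.BirchSwinnertonDyer.Theorems.GL1Cartan

end
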